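import Summits.Ventures.LatticeQCDFlow.Scoring.NonabelianAreaLaw2D
import HarnessLib

/-!
# The exact non-abelian area law in two dimensions for EVERY compact gauge group, II: `∫ ρ(W_{R×T})_{ab} ∏_p w(U_p) dHaar^{⊗E} = (M^{RT})_{ab}`

HONEST FRAMING: exact (Metropolis-corrected) sampling algorithms for lattice gauge theory;
figures of merit are autocorrelation/cost numbers at stated couplings and volumes; no
continuum-physics claim.

Venture `LatticeQCDFlow` (cell pub-lqcd), sub-topic `Scoring`; FANOUT row 5 (`s0-sun-a`), GEN-18.
NEW WORK of the cell (placement rule); part II of the lead's NOT-TYPED item "general-`N` free-boundary area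
law" — for EVERY compact second-countable group `G`, every continuous representation `ρ : G →* M_N(ℂ)` and
every continuous class-function weight `w` (e.g. the Wilson weight `e^{−β(N − Re tr ρ)}` at ANY real `β`),
without characters, Peter–Weyl or gauge fixing, from the tools of part I (`Scoring/NonabelianAreaLaw2D`:
one-link peeling, column absorption, column Stokes identity).

Setting: the torus `(ℤ/L)²` of the tree (`Literature…ConstructiveQFTWave0`), product Haar measure
`Haar^{⊗E}` on the links, the `R × T` loop `W = rectangleHolonomy U (i,j) 0 1 R T` with corner `(i, j)`
and the plaquettes `B = {(i+a, j+b) : a < R, b < T}` it ENCLOSES, weighted by `∏_{p∈B} w(U_p)` — the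
free-boundary (open) `R × T` lattice realised inside the torus (`R + 1 ≤ L`, `T + 1 ≤ L`: the remaining
links are Haar dummies), the loop running along its boundary.  `M := ∫ ρ(g) w(g) dg` (entrywise).

* §4 **`integral_rep_rectangleHolonomy_mul_prod_weight`** — THE MATRIX AREA LAW:
  `∫ ρ(W)_{ab} ∏_{p∈B} w(U_p) dHaar^{⊗E} = (M^{RT})_{ab}` for all `a, b` (induction on `R`: the right links of
  the added column are private; by the column Stokes identity the new loop is the product of the column's
  plaquettes transported to the corner — words in those private links with coefficients that ignore them
  — times the old loop, and column absorption turns the column into `M^T`; the class property of `w` is used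
  once, to read the weight of a plaquette off its transported holonomy);
  bookkeeping: `continuous_config_lineHolonomy/rectangleHolonomy/plaquetteHolonomy`,
  `lineHolonomy_update_of_snd_ne`, `lineHolonomy_one_update_of_fst_ne`, `rectangleHolonomy_update_col`,
  `plaquetteHolonomy_update_col_of_mem_rect`, `prod_rect_succ_eq`;
* part III (`Scoring/NonabelianAreaLaw2DOpenWilsonLoop.lean`) normalises: the free-boundary partition
  function factorises (`∫ ∏_{p∈B} w(U_p) = (∫ w)^{RT}`, the case `ρ = 1`), the Wilson-loop MATRIX is
  `⟨ρ(W)_{ab}⟩_{B,w} = ((M/∫w)^{RT})_{ab}`, and for scalar `M = c·1` (Schur) the tree's `wilsonLoop` obeys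
  `⟨W_{R×T}⟩_{B,w} = Re((c/∫w)^{RT})` exactly; part IV does `M = c·1` for the defining representations of
  `U(N)` and `SU(N)`.

Published forms: Gross–Witten, Phys. Rev. D 21 (1980) 446 §II; Balian–Drouffe–Itzykson, Phys. Rev. D 11
(1975) 2104; Migdal, Sov. Phys. JETP 42 (1975) 413.  Companions: row 30's `Scaling/PlaquetteIndependence2D`
(single-plaquette functions), row 5 GEN-12's `SU2OpenRectangleWilsonLoops` (`SU(2)` by characters: there the
loop may sit anywhere inside a larger open rectangle; here the weighted region is the loop's own interior —
the outer plaquettes of a larger free-boundary lattice peel off by part I §1 and do not change the value,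
left to a sequel).  No `def`, nothing cited as a fact, 0 sorry.
-/

noncomputable section

open MeasureTheory Function Finset
open Literature.MathematicalPhysics.QuantumFieldTheory
open Summit.Ventures.LatticeQCDFlow.Theory2.Lattice
open Summit.Ventures.LatticeQCDFlow.Theory2.Lattice.TwoDim

namespace Summit.Ventures.LatticeQCDFlow.Scoring

variable {L : ℕ} [NeZero L] {G : Type*} [Group G] [TopologicalSpace G] [IsTopologicalGroup G]
  [CompactSpace G] [SecondCountableTopology G] [MeasurableSpace G] [BorelSpace G]

/-! ## §4. The matrix area law -/

section AreaLaw

omit [NeZero L] [CompactSpace G] [SecondCountableTopology G] [MeasurableSpace G] [BorelSpace G] in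
/-- Line holonomies are continuous functions of the configuration. -/
theorem continuous_config_lineHolonomy {d : ℕ} (k : Fin d) :
    ∀ (n : ℕ) (y : Site d L), Continuous fun U : GaugeConfig d L G => lineHolonomy U k n y
  | 0, _ => continuous_const
  | n + 1, y => by
    show Continuous fun U : GaugeConfig d L G => U (y, k) * lineHolonomy U k n (y.shift k)
    exact (continuous_apply _).mul (continuous_config_lineHolonomy k n (y.shift k))

omit [NeZero L] [CompactSpace G] [SecondCountableTopology G] [MeasurableSpace G] [BorelSpace G] in
/-- The rectangular loop is a continuous function of the configuration. -/
theorem continuous_config_rectangleHolonomy {d : ℕ} (x : Site d L) (k l : Fin d) (R T : ℕ) :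
    Continuous fun U : GaugeConfig d L G => rectangleHolonomy U x k l R T := by
  unfold rectangleHolonomy
  exact (((continuous_config_lineHolonomy k R x).mul (continuous_config_lineHolonomy l T _)).mul
    (continuous_config_lineHolonomy k R _).inv).mul (continuous_config_lineHolonomy l T x).inv

omit [NeZero L] [CompactSpace G] [SecondCountableTopology G] [MeasurableSpace G] [BorelSpace G] in
/-- The plaquette holonomy is a continuous function of the configuration. -/
theorem continuous_config_plaquetteHolonomy {d : ℕ} (x : Site d L) (k l : Fin d) :
    Continuous fun U : GaugeConfig d L G => plaquetteHolonomy U x k l := by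
  unfold plaquetteHolonomy
  fun_prop

omit [NeZero L] [TopologicalSpace G] [IsTopologicalGroup G] [CompactSpace G] [SecondCountableTopology G]
  [MeasurableSpace G] [BorelSpace G] in
/-- A line in direction `k` ignores every link of the other direction `k'`. -/
theorem lineHolonomy_update_of_snd_ne {U : GaugeConfig 2 L G} {k k' : Fin 2} (hk : k ≠ k')
    (x : Site 2 L) (g : G) (n : ℕ) (y : Site 2 L) :
    lineHolonomy (update U (x, k') g) k n y = lineHolonomy U k n y :=
  lineHolonomy_congr k n y fun _ _ => update_of_ne (fun h => hk (congrArg Prod.snd h)) _ _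

omit [NeZero L] [TopologicalSpace G] [IsTopologicalGroup G] [CompactSpace G] [SecondCountableTopology G]
  [MeasurableSpace G] [BorelSpace G] in
/-- A vertical line in column `x` ignores the vertical links of every other column `x'`. -/
theorem lineHolonomy_one_update_of_fst_ne {U : GaugeConfig 2 L G} {x x' : ZMod L} (hx : x ≠ x')
    (y y' : ZMod L) (g : G) (n : ℕ) :
    lineHolonomy (update U (![x', y'], 1) g) 1 n ![x, y] = lineHolonomy U 1 n ![x, y] :=
  lineHolonomy_congr 1 n _ fun s _ => by
    rw [vec2_add_single_one]
    exact update_of_ne (fun h => hx (vec2_eq_iff.mp (congrArg Prod.fst h)).1) _ _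

omit [NeZero L] [TopologicalSpace G] [IsTopologicalGroup G] [CompactSpace G] [SecondCountableTopology G]
  [MeasurableSpace G] [BorelSpace G] in
/-- The `R × T` loop with corner `(i, j)` ignores the vertical links of every column other than `i`
and `i + R`. -/
theorem rectangleHolonomy_update_col {U : GaugeConfig 2 L G} (i j : ZMod L) (R T : ℕ) {x' : ZMod L}
    (h0 : i ≠ x') (hR : i + R ≠ x') (y' : ZMod L) (g : G) :
    rectangleHolonomy (update U (![x', y'], 1) g) ![i, j] 0 1 R T = rectangleHolonomy U ![i, j] 0 1 R T := by
  rw [rectangleHolonomy_vec2, rectangleHolonomy_vec2,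
    lineHolonomy_update_of_snd_ne (k := 0) (k' := 1) (by decide),
    lineHolonomy_update_of_snd_ne (k := 0) (k' := 1) (by decide),
    lineHolonomy_one_update_of_fst_ne hR, lineHolonomy_one_update_of_fst_ne h0]

omit [NeZero L] [TopologicalSpace G] [IsTopologicalGroup G] [CompactSpace G] [SecondCountableTopology G]
  [MeasurableSpace G] [BorelSpace G] in
/-- A plaquette of the `R × T` rectangle with corner `(i, j)` ignores the vertical links of the column
`i + R + 1` (`R + 2 ≤ L`). -/
theorem plaquetteHolonomy_update_col_of_mem_rect {U : GaugeConfig 2 L G} (i j : ZMod L) {R T : ℕ}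
    (hR : R + 2 ≤ L) {p : Site 2 L}
    (hp : p ∈ (range R ×ˢ range T).image (fun q : ℕ × ℕ => (![i + q.1, j + q.2] : Site 2 L)))
    (y' : ZMod L) (g : G) :
    plaquetteHolonomy (update U (![i + R + 1, y'], 1) g) p 0 1 = plaquetteHolonomy U p 0 1 := by
  obtain ⟨⟨a', b'⟩, hq, rfl⟩ := Finset.mem_image.mp hp
  rw [Finset.mem_product, Finset.mem_range, Finset.mem_range] at hq
  refine plaquetteHolonomy_update_vert g (fun h => ?_) (fun h => ?_)
  · have h1 := (vec2_eq_iff.mp h).1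
    rw [add_assoc] at h1
    refine natCast_zmod_ne_of_lt (L := L) (j := a') (k := R + 1) (by omega) (by omega) (by omega) ?_
    push_cast
    exact add_left_cancel h1
  · rw [shift_vec2_zero] at h
    have h1 := (vec2_eq_iff.mp h).1
    rw [add_assoc, add_assoc] at h1
    refine natCast_zmod_ne_of_lt (L := L) (j := a' + 1) (k := R + 1) (by omega) (by omega) (by omega) ?_
    push_cast
    exact add_left_cancel h1

omit [NeZero L] [Group G] [TopologicalSpace G] [IsTopologicalGroup G] [CompactSpace G]
  [SecondCountableTopology G] [MeasurableSpace G] [BorelSpace G] in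
/-- Splitting off the last column of a product over the `(R+1) × T` rectangle. -/
theorem prod_rect_succ_eq {M' : Type*} [CommMonoid M'] (i j : ZMod L) {R T : ℕ} (hR : R + 1 ≤ L)
    (hT : T ≤ L) (f : Site 2 L → M') :
    ∏ x ∈ (range (R + 1) ×ˢ range T).image (fun q : ℕ × ℕ => (![i + q.1, j + q.2] : Site 2 L)), f x =
      (∏ b ∈ range T, f ![i + R, j + b]) *
        ∏ x ∈ (range R ×ˢ range T).image (fun q : ℕ × ℕ => (![i + q.1, j + q.2] : Site 2 L)), f x := by
  rw [prod_rect_eq i j hR hT, prod_rect_eq i j (by omega) hT]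
  simp_rw [Finset.prod_range_succ]
  rw [Finset.prod_mul_distrib, mul_comm]

/-- **THE MATRIX AREA LAW** (every compact gauge group, every continuous representation, every continuous
class-function weight).  On `(ℤ/L)²` with `R + 1 ≤ L`, `T + 1 ≤ L`, for the `R × T` loop `W` with corner
`(i, j)` and the one-plaquette weights on the `RT` plaquettes it encloses,
`∫ ρ(W)_{ab} · ∏_{p} w(U_p) dHaar^{⊗E} = (M^{RT})_{ab}`, `M_{kl} = ∫ ρ(g)_{kl} w(g) dg`. -/
theorem integral_rep_rectangleHolonomy_mul_prod_weight {N : ℕ} (ρ : G →* Matrix (Fin N) (Fin N) ℂ)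
    (hρ : Continuous ρ) {w : G → ℝ} (hw : Continuous w) (hwc : ∀ k g, w (k * g * k⁻¹) = w g)
    (i j : ZMod L) {T : ℕ} (hT : T + 1 ≤ L) :
    ∀ {R : ℕ}, R + 1 ≤ L → ∀ a b : Fin N,
      ∫ U, ρ (rectangleHolonomy U ![i, j] 0 1 R T) a b *
          ∏ p ∈ (range R ×ˢ range T).image (fun q : ℕ × ℕ => (![i + q.1, j + q.2] : Site 2 L)),
            (w (plaquetteHolonomy U p 0 1) : ℂ) ∂(Measure.pi fun _ : Edge 2 L => haarProbability G) =
        ((Matrix.of fun k l : Fin N => ∫ g, ρ g k l * (w g : ℂ) ∂(haarProbability G)) ^ (R * T)) a b := by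
  intro R
  induction R with
  | zero =>
    intro _ a b
    have h1 : ∀ U : GaugeConfig 2 L G, rectangleHolonomy U ![i, j] 0 1 0 T = 1 := fun U => by
      rw [rectangleHolonomy_vec2]; simp
    simp [h1]
  | succ R ih =>
    intro hR a b
    set M : Matrix (Fin N) (Fin N) ℂ :=
      Matrix.of fun k l : Fin N => ∫ g, ρ g k l * (w g : ℂ) ∂(haarProbability G) with hM
    have ih' := ih (show R + 1 ≤ L by omega)
    have hTL : T ≤ L := by omega
    haveI : Fact (1 < L) := ⟨by omega⟩
    -- two facts about columns mod `L`
    have hz2 : (i + R : ZMod L) ≠ i + R + 1 := fun h => one_ne_zero (left_eq_add.mp h)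
    have hz3 : (i : ZMod L) ≠ i + R + 1 := by
      intro h
      rw [add_assoc] at h
      have h' : ((R + 1 : ℕ) : ZMod L) = ((0 : ℕ) : ZMod L) := by
        push_cast; exact (left_eq_add.mp h)
      exact natCast_zmod_ne_of_lt (L := L) (j := R + 1) (k := 0) (by omega) (by omega) (by omega) h'
    -- the column data: private links `e c` (right links of the column `i + R`), words `A c · U_{e c} · B c`
    let e : ℕ → Edge 2 L := fun c => (![i + R + 1, j + c], 1)
    let A : ℕ → GaugeConfig 2 L G → G := fun c U =>
      lineHolonomy U 0 R ![i, j] * lineHolonomy U 1 c ![i + R, j] * U (![i + R, j + c], 0)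
    let B : ℕ → GaugeConfig 2 L G → G := fun c U =>
      (U (![i + R, j + c + 1], 0))⁻¹ * (U (![i + R, j + c], 1))⁻¹ * (lineHolonomy U 1 c ![i + R, j])⁻¹ *
        (lineHolonomy U 0 R ![i, j])⁻¹
    let Ψ : GaugeConfig 2 L G → ℂ := fun U =>
      ∏ p ∈ (range R ×ˢ range T).image (fun q : ℕ × ℕ => (![i + q.1, j + q.2] : Site 2 L)),
        (w (plaquetteHolonomy U p 0 1) : ℂ)
    have he : ∀ c < T, ∀ c' < T, e c = e c' → c = c' := by
      intro c hc c' hc' h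
      have h1 : (![i + R + 1, j + c] : Site 2 L) = ![i + R + 1, j + c'] := congrArg Prod.fst h
      have h2 := add_left_cancel (vec2_eq_iff.mp h1).2
      by_contra hne
      exact natCast_zmod_ne_of_lt (L := L) (by omega) (by omega) hne h2
    have hA : ∀ c, Continuous (A c) := fun c => by
      show Continuous fun U : GaugeConfig 2 L G =>
        lineHolonomy U 0 R ![i, j] * lineHolonomy U 1 c ![i + R, j] * U (![i + R, j + c], 0)
      exact ((continuous_config_lineHolonomy 0 R _).mul (continuous_config_lineHolonomy 1 c _)).mul
        (continuous_apply _)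
    have hev : ∀ e' : Edge 2 L, Continuous fun U : GaugeConfig 2 L G => U e' := fun e' => continuous_apply e'
    have hB : ∀ c, Continuous (B c) := fun c => by
      show Continuous fun U : GaugeConfig 2 L G =>
        (U (![i + R, j + c + 1], 0))⁻¹ * (U (![i + R, j + c], 1))⁻¹ * (lineHolonomy U 1 c ![i + R, j])⁻¹ *
          (lineHolonomy U 0 R ![i, j])⁻¹
      exact (((hev ((![i + R, j + c + 1], 0) : Edge 2 L)).inv.mul
        (hev ((![i + R, j + c], 1) : Edge 2 L)).inv).mul
        (continuous_config_lineHolonomy (1 : Fin 2) c (![i + R, j] : Site 2 L)).inv).mul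
        (continuous_config_lineHolonomy (0 : Fin 2) R (![i, j] : Site 2 L)).inv
    have hh : ∀ c c' : ℕ, ((![i + R, j + c], 0) : Edge 2 L) ≠ (![i + R + 1, j + c'], 1) := by
      intro c c' h
      have h2 : (0 : Fin 2) = 1 := congrArg Prod.snd h
      exact absurd h2 (by decide)
    have hh' : ∀ c c' : ℕ, ((![i + R, j + c + 1], 0) : Edge 2 L) ≠ (![i + R + 1, j + c'], 1) := by
      intro c c' h
      have h2 : (0 : Fin 2) = 1 := congrArg Prod.snd h
      exact absurd h2 (by decide)
    have hv : ∀ c c' : ℕ, ((![i + R, j + c], 1) : Edge 2 L) ≠ (![i + R + 1, j + c'], 1) :=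
      fun c c' h => hz2 (vec2_eq_iff.mp (congrArg Prod.fst h)).1
    have hAe : ∀ c c' U g, A c (update U (e c') g) = A c U := by
      intro c c' U g
      show lineHolonomy (update U (![i + R + 1, j + c'], 1) g) 0 R ![i, j] *
          lineHolonomy (update U (![i + R + 1, j + c'], 1) g) 1 c ![i + R, j] *
          update U (![i + R + 1, j + c'], 1) g (![i + R, j + c], 0) = _
      rw [lineHolonomy_update_of_snd_ne (k := 0) (k' := 1) (by decide), lineHolonomy_one_update_of_fst_ne hz2,
        update_of_ne (hh c c')]
    have hBe : ∀ c c' U g, B c (update U (e c') g) = B c U := by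
      intro c c' U g
      show (update U (![i + R + 1, j + c'], 1) g (![i + R, j + c + 1], 0))⁻¹ *
          (update U (![i + R + 1, j + c'], 1) g (![i + R, j + c], 1))⁻¹ *
          (lineHolonomy (update U (![i + R + 1, j + c'], 1) g) 1 c ![i + R, j])⁻¹ *
          (lineHolonomy (update U (![i + R + 1, j + c'], 1) g) 0 R ![i, j])⁻¹ = _
      rw [update_of_ne (hh' c c'), update_of_ne (hv c c'), lineHolonomy_one_update_of_fst_ne hz2,
        lineHolonomy_update_of_snd_ne (k := 0) (k' := 1) (by decide)]
    have hK : Continuous fun U : GaugeConfig 2 L G => ρ (rectangleHolonomy U ![i, j] 0 1 R T) :=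
      hρ.comp (continuous_config_rectangleHolonomy _ 0 1 R T)
    have hKe : ∀ c U g, (fun U : GaugeConfig 2 L G => ρ (rectangleHolonomy U ![i, j] 0 1 R T))
        (update U (e c) g) = ρ (rectangleHolonomy U ![i, j] 0 1 R T) := by
      intro c U g
      show ρ (rectangleHolonomy (update U (![i + R + 1, j + c], 1) g) ![i, j] 0 1 R T) = _
      rw [rectangleHolonomy_update_col i j R T hz3 hz2]
    have hΨ : Continuous Ψ :=
      continuous_finsetProd _ fun p _ =>
        Complex.continuous_ofReal.comp (hw.comp (continuous_config_plaquetteHolonomy p 0 1))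
    have hΨe : ∀ c U g, Ψ (update U (e c) g) = Ψ U := by
      intro c U g
      exact Finset.prod_congr rfl fun p hp => by
        rw [plaquetteHolonomy_update_col_of_mem_rect i j hR hp]
    -- each word is the transported plaquette of the new column
    have hconj : ∀ (c : ℕ) (U : GaugeConfig 2 L G), A c U * U (e c) * B c U =
        (lineHolonomy U 0 R ![i, j] * lineHolonomy U 1 c ![i + R, j]) *
          plaquetteHolonomy U ![i + R, j + c] 0 1 *
          (lineHolonomy U 0 R ![i, j] * lineHolonomy U 1 c ![i + R, j])⁻¹ := by
      intro c U
      simp only [A, B, e, plaquetteHolonomy, shift_vec2_zero, shift_vec2_one]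
      group
    -- pointwise: the integrand in the shape of §2
    have hpt : ∀ U : GaugeConfig 2 L G,
        ρ (rectangleHolonomy U ![i, j] 0 1 (R + 1) T) a b *
            ∏ p ∈ (range (R + 1) ×ˢ range T).image (fun q : ℕ × ℕ => (![i + q.1, j + q.2] : Site 2 L)),
              (w (plaquetteHolonomy U p 0 1) : ℂ) =
          (((List.range T).map fun c => ρ (A c U * U (e c) * B c U)).prod *
              ρ (rectangleHolonomy U ![i, j] 0 1 R T)) a b *
            ((∏ c ∈ range T, (w (A c U * U (e c) * B c U) : ℂ)) * Ψ U) := by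
      intro U
      rw [prod_rect_succ_eq i j (R := R) (T := T) (by omega) hTL, rectangleHolonomy_succ_eq_listProd_mul, map_mul,
        map_list_prod, List.map_map]
      congr 2
      refine Finset.prod_congr rfl fun c _ => ?_
      rw [hconj, hwc]
    have hint : ∀ d : Fin N, Integrable (fun U : GaugeConfig 2 L G =>
        (M ^ T) a d * (ρ (rectangleHolonomy U ![i, j] 0 1 R T) d b * Ψ U))
        (Measure.pi fun _ : Edge 2 L => haarProbability G) := fun d =>
      (integrable_gaugeConfig_of_continuous ((hK.matrix_elem d b).mul hΨ)).const_mul _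
    have hsplit : ∀ U : GaugeConfig 2 L G,
        (M ^ T * ρ (rectangleHolonomy U ![i, j] 0 1 R T)) a b * Ψ U =
          ∑ d, (M ^ T) a d * (ρ (rectangleHolonomy U ![i, j] 0 1 R T) d b * Ψ U) := fun U => by
      rw [Matrix.mul_apply, Finset.sum_mul]
      exact Finset.sum_congr rfl fun d _ => mul_assoc _ _ _
    calc ∫ U, ρ (rectangleHolonomy U ![i, j] 0 1 (R + 1) T) a b *
            ∏ p ∈ (range (R + 1) ×ˢ range T).image (fun q : ℕ × ℕ => (![i + q.1, j + q.2] : Site 2 L)),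
              (w (plaquetteHolonomy U p 0 1) : ℂ) ∂(Measure.pi fun _ : Edge 2 L => haarProbability G)
        = ∫ U, (((List.range T).map fun c => ρ (A c U * U (e c) * B c U)).prod *
              ρ (rectangleHolonomy U ![i, j] 0 1 R T)) a b *
            ((∏ c ∈ range T, (w (A c U * U (e c) * B c U) : ℂ)) * Ψ U)
            ∂(Measure.pi fun _ : Edge 2 L => haarProbability G) := integral_congr_ae (ae_of_all _ hpt)
      _ = ∫ U, (M ^ T * ρ (rectangleHolonomy U ![i, j] 0 1 R T)) a b * Ψ U
            ∂(Measure.pi fun _ : Edge 2 L => haarProbability G) :=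
          integral_listProd_words_mul ρ hρ hw T e A B
            (fun U : GaugeConfig 2 L G => ρ (rectangleHolonomy U ![i, j] 0 1 R T)) Ψ he hA hB hAe hBe
            hK hKe hΨ hΨe a b
      _ = ∑ d, (M ^ T) a d * ∫ U, ρ (rectangleHolonomy U ![i, j] 0 1 R T) d b * Ψ U
            ∂(Measure.pi fun _ : Edge 2 L => haarProbability G) := by
          rw [integral_congr_ae (ae_of_all _ hsplit), integral_finsetSum _ fun d _ => hint d]
          exact Finset.sum_congr rfl fun d _ => integral_const_mul _ _
      _ = ∑ d, (M ^ T) a d * (M ^ (R * T)) d b := Finset.sum_congr rfl fun d _ => by rw [ih' d b]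
      _ = (M ^ T * M ^ (R * T)) a b := (Matrix.mul_apply).symm
      _ = (M ^ ((R + 1) * T)) a b := by rw [← pow_add, show T + R * T = (R + 1) * T by ring]

end AreaLaw


/-! ## §5. The area law on a general index type and for two representations at once (GEN-21):
`∫ ρ(W)_{ab} σ(W)_{cd} ∏_p w(U_p) = ((M_{ρ⊗σ})^{RT})_{(a,c),(b,d)}`, `M_{ρ⊗σ} = ∫ (ρ(g) ⊗ₖ σ(g)) w(g) dg` (§4 for
the Kronecker representation), hence `∫ tr ρ(W)·tr σ(W) ∏_p w(U_p) = tr((M_{ρ⊗σ})^{RT})` — the second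
moments of Wilson loops (`σ = ρ̄`: `|tr ρ(W)|²`) obey a matrix area law of their own. -/
section Kronecker
open scoped Kronecker
/-- §4 for a representation on an arbitrary finite index type `n` (transport along `n ≃ Fin |n|`). -/
theorem integral_rep_rectangleHolonomy_mul_prod_weight_fintype {n : Type*} [Fintype n] [DecidableEq n]
    (ρ : G →* Matrix n n ℂ) (hρ : Continuous ρ) {w : G → ℝ} (hw : Continuous w)
    (hwc : ∀ k g, w (k * g * k⁻¹) = w g) (i j : ZMod L) {T : ℕ} (hT : T + 1 ≤ L) {R : ℕ} (hR : R + 1 ≤ L)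
    (a b : n) :
    ∫ U, ρ (rectangleHolonomy U ![i, j] 0 1 R T) a b *
        ∏ p ∈ (range R ×ˢ range T).image (fun q : ℕ × ℕ => (![i + q.1, j + q.2] : Site 2 L)),
          (w (plaquetteHolonomy U p 0 1) : ℂ) ∂(Measure.pi fun _ : Edge 2 L => haarProbability G) =
      ((Matrix.of fun k l : n => ∫ g, ρ g k l * (w g : ℂ) ∂(haarProbability G)) ^ (R * T)) a b := by
  set e := Fintype.equivFin n
  set ρ' : G →* Matrix (Fin (Fintype.card n)) (Fin (Fintype.card n)) ℂ :=
    (Matrix.reindexAlgEquiv ℂ ℂ e).toRingEquiv.toMulEquiv.toMonoidHom.comp ρ with hρ'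
  have hρ'a : ∀ g k l, ρ' g k l = ρ g (e.symm k) (e.symm l) := fun g k l => by
    simp [hρ', Matrix.reindex_apply, Matrix.submatrix_apply]
  have hρ'c : Continuous ρ' := continuous_matrix fun k l => by
    simpa only [hρ'a] using hρ.matrix_elem (e.symm k) (e.symm l)
  have h := integral_rep_rectangleHolonomy_mul_prod_weight ρ' hρ'c hw hwc i j hT hR (e a) (e b)
  simp only [hρ'a, Equiv.symm_apply_apply] at h
  have hM : (Matrix.of fun k l : Fin (Fintype.card n) =>
      ∫ g, ρ g (e.symm k) (e.symm l) * (w g : ℂ) ∂(haarProbability G)) = Matrix.reindexAlgEquiv ℂ ℂ e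
        (Matrix.of fun k l : n => ∫ g, ρ g k l * (w g : ℂ) ∂(haarProbability G)) := by
    ext k l; simp [Matrix.reindex_apply, Matrix.submatrix_apply]
  rw [h, hM, ← map_pow, Matrix.coe_reindexAlgEquiv, Matrix.reindex_apply, Matrix.submatrix_apply,
    Equiv.symm_apply_apply, Equiv.symm_apply_apply]

/-- **The area law for two representations at once.**  For continuous representations `ρ`, `σ` of the
compact group `G` and a continuous class-function weight `w`: `∫ ρ(W)_{ab} σ(W)_{cd} ∏_p w(U_p) dHaar^{⊗E} =
((M_{ρ⊗σ})^{RT})_{(a,c),(b,d)}`, `M_{ρ⊗σ} = ∫ (ρ(g) ⊗ₖ σ(g)) w(g) dg` (§4 for `g ↦ ρ(g) ⊗ₖ σ(g)`). -/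
theorem integral_rep_mul_rep_rectangleHolonomy_mul_prod_weight {n m : Type*} [Fintype n] [DecidableEq n]
    [Fintype m] [DecidableEq m] (ρ : G →* Matrix n n ℂ) (σ : G →* Matrix m m ℂ) (hρ : Continuous ρ)
    (hσ : Continuous σ) {w : G → ℝ} (hw : Continuous w) (hwc : ∀ k g, w (k * g * k⁻¹) = w g)
    (i j : ZMod L) {T : ℕ} (hT : T + 1 ≤ L) {R : ℕ} (hR : R + 1 ≤ L) (a b : n) (c d : m) :
    ∫ U, ρ (rectangleHolonomy U ![i, j] 0 1 R T) a b * σ (rectangleHolonomy U ![i, j] 0 1 R T) c d *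
        ∏ p ∈ (range R ×ˢ range T).image (fun q : ℕ × ℕ => (![i + q.1, j + q.2] : Site 2 L)),
          (w (plaquetteHolonomy U p 0 1) : ℂ) ∂(Measure.pi fun _ : Edge 2 L => haarProbability G) =
      ((Matrix.of fun k l : n × m => ∫ g, (ρ g ⊗ₖ σ g) k l * (w g : ℂ) ∂(haarProbability G)) ^ (R * T))
        (a, c) (b, d) := by
  let τ : G →* Matrix (n × m) (n × m) ℂ :=
    { toFun := fun g => ρ g ⊗ₖ σ g
      map_one' := by rw [map_one, map_one, Matrix.one_kronecker_one]
      map_mul' := fun g h => by rw [map_mul, map_mul, Matrix.mul_kronecker_mul] }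
  have hτa : ∀ g (k l : n × m), τ g k l = ρ g k.1 l.1 * σ g k.2 l.2 := fun g k l => rfl
  have hτc : Continuous τ := continuous_matrix fun k l => by
    simp only [hτa]; exact (hρ.matrix_elem k.1 l.1).mul (hσ.matrix_elem k.2 l.2)
  simpa only [hτa, Matrix.kroneckerMap_apply] using
    integral_rep_rectangleHolonomy_mul_prod_weight_fintype τ hτc hw hwc i j hT hR (a, c) (b, d)

/-- **Second moments of Wilson loops, trace form**: `∫ tr ρ(W)·tr σ(W) ∏_p w(U_p) = tr((M_{ρ⊗σ})^{RT})`. -/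
theorem integral_trace_mul_trace_rectangleHolonomy_mul_prod_weight {n m : Type*} [Fintype n]
    [DecidableEq n] [Fintype m] [DecidableEq m] (ρ : G →* Matrix n n ℂ) (σ : G →* Matrix m m ℂ)
    (hρ : Continuous ρ) (hσ : Continuous σ) {w : G → ℝ} (hw : Continuous w)
    (hwc : ∀ k g, w (k * g * k⁻¹) = w g) (i j : ZMod L) {T : ℕ} (hT : T + 1 ≤ L) {R : ℕ} (hR : R + 1 ≤ L) :
    ∫ U, (ρ (rectangleHolonomy U ![i, j] 0 1 R T)).trace * (σ (rectangleHolonomy U ![i, j] 0 1 R T)).trace *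
        ∏ p ∈ (range R ×ˢ range T).image (fun q : ℕ × ℕ => (![i + q.1, j + q.2] : Site 2 L)),
          (w (plaquetteHolonomy U p 0 1) : ℂ) ∂(Measure.pi fun _ : Edge 2 L => haarProbability G) =
      ((Matrix.of fun k l : n × m => ∫ g, (ρ g ⊗ₖ σ g) k l * (w g : ℂ) ∂(haarProbability G)) ^ (R * T)).trace := by
  set Ψ : GaugeConfig 2 L G → ℂ := fun U =>
    ∏ p ∈ (range R ×ˢ range T).image (fun q : ℕ × ℕ => (![i + q.1, j + q.2] : Site 2 L)),
      (w (plaquetteHolonomy U p 0 1) : ℂ) with hΨ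
  have hW := continuous_config_rectangleHolonomy (L := L) (G := G) (![i, j] : Site 2 L) 0 1 R T
  have hΨc : Continuous Ψ := continuous_finsetProd _ fun p _ =>
    Complex.continuous_ofReal.comp (hw.comp (continuous_config_plaquetteHolonomy p 0 1))
  have hint : ∀ (x : n) (y : m), Integrable (fun U : GaugeConfig 2 L G =>
      ρ (rectangleHolonomy U ![i, j] 0 1 R T) x x * σ (rectangleHolonomy U ![i, j] 0 1 R T) y y * Ψ U)
        (Measure.pi fun _ : Edge 2 L => haarProbability G) := fun x y =>
    integrable_gaugeConfig_of_continuous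
      ((((hρ.comp hW).matrix_elem x x).mul ((hσ.comp hW).matrix_elem y y)).mul hΨc)
  have hpt : ∀ U : GaugeConfig 2 L G, (ρ (rectangleHolonomy U ![i, j] 0 1 R T)).trace *
      (σ (rectangleHolonomy U ![i, j] 0 1 R T)).trace * Ψ U = ∑ x, ∑ y,
        ρ (rectangleHolonomy U ![i, j] 0 1 R T) x x * σ (rectangleHolonomy U ![i, j] 0 1 R T) y y * Ψ U := by
    intro U
    rw [Matrix.trace, Matrix.trace, Finset.sum_mul, Finset.sum_mul]
    refine Finset.sum_congr rfl fun x _ => ?_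
    rw [Matrix.diag_apply, Finset.mul_sum, Finset.sum_mul]
    rfl
  rw [integral_congr_ae (ae_of_all _ hpt), integral_finsetSum _ fun x _ => integrable_finsetSum _ fun y _ =>
    hint x y, Matrix.trace, Fintype.sum_prod_type]
  refine Finset.sum_congr rfl fun x _ => ?_
  rw [integral_finsetSum _ fun y _ => hint x y]
  exact Finset.sum_congr rfl fun y _ =>
    integral_rep_mul_rep_rectangleHolonomy_mul_prod_weight ρ σ hρ hσ hw hwc i j hT hR x x y y

end Kronecker
end Summit.Ventures.LatticeQCDFlow.Scoring
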